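import Summits.PneNP.PneNP.Theorems.SoloInformedIOShape
import Literature.Computability.Complexity.PSelectiveHardSets
import HarnessLib

/-!
# Solo (informed) — the semi-feasibility margin of `P ≠ NP`: no selector for `SAT`

`PneNP` is stated as `∃ L ∈ NP, L ∉ P`. A **selector** for a language `T` is a polynomial-time
`s` with `s ⟨a, b⟩ ∈ {a, b}` and `(a ∈ T ∨ b ∈ T) → s ⟨a, b⟩ ∈ T` (Selman's P-selective /
semi-feasible sets: `s` picks, of two instances, one "at least as likely" to be in `T`, and is never
wrong when exactly one of them is). This file records, as kernel-checked equivalences: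

* `soloInformed_pneNP_iff_no_pSelective_hard_set` — `PneNP` iff NO `NP`-hard language (Karp) is
  P-selective (Selman 1979 / Hemaspaandra–Torenvliet Thm. 4.1, reproduced in
  `Literature/Computability/Complexity/PSelectiveHardSets.lean`);
* `soloInformed_pneNP_iff_no_selector_for_SAT` — `PneNP` iff `SAT` has no selector: every
  polynomial-time "preference heuristic" that, given two formulas, names one of them, sometimes
  names an unsatisfiable formula although the other one was satisfiable.

Reading (sharpest-statement file, semi-feasibility margin): deciding `SAT` is not required to
refute `P ≠ NP` — a correct pairwise preference already is; so any proof of `P ≠ NP` must in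
particular defeat every polynomial-time tournament/ranking heuristic on satisfiable-vs-unsatisfiable
pairs, and conversely nothing weaker than that in this direction is the summit.
-/

namespace Summit.PneNP.PneNP.Theorems

open Literature.Computability.Complexity _root_.Computability

/-- **`P ≠ NP` iff no `NP`-hard set is P-selective.**
[cite: Selman1979, main theorem (theorem number not verified: source not held)]
[cite: HemaspaandraTorenvliet2003, Thm. 4.1 (held book:hemaspaandra2003-theory-semi-feasible-algorithms chunk p0099)] -/
theorem soloInformed_pneNP_iff_no_pSelective_hard_set :
    PneNP ↔ ∀ T : Language Bool, IsHard Nondeterministic.NP T →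
      ¬ ∃ s ∈ FP, ∀ a b : List Bool, (s (boolPair a b) = a ∨ s (boolPair a b) = b) ∧
        ((a ∈ T ∨ b ∈ T) → s (boolPair a b) ∈ T) := by
  rw [soloInformed_pneNP_iff_exists_not_mem, ← Set.not_subset, ← exists_isHard_selector_iff]
  exact ⟨fun h T hT hs => h ⟨T, hT, hs⟩, fun h ⟨T, hT, hs⟩ => h T hT hs⟩

/-- **`P ≠ NP` iff `SAT` has no polynomial-time selector.**
[cite: Selman1979, main theorem (theorem number not verified: source not held)]
[cite: HemaspaandraTorenvliet2003, Thm. 1.6 (held book:hemaspaandra2003-theory-semi-feasible-algorithms chunk p0039)] -/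
theorem soloInformed_pneNP_iff_no_selector_for_SAT :
    PneNP ↔ ¬ ∃ s ∈ FP, ∀ a b : List Bool, (s (boolPair a b) = a ∨ s (boolPair a b) = b) ∧
        ((a ∈ SAT ∨ b ∈ SAT) → s (boolPair a b) ∈ SAT) := by
  constructor
  · intro h hs
    exact soloInformed_pneNP_iff_no_pSelective_hard_set.1 h SAT isNPComplete_SAT_holds.isHard hs
  · intro h
    rw [soloInformed_pneNP_iff_exists_not_mem, ← Set.not_subset]
    intro hsub
    exact h (exists_selector_of_mem_P (hsub isNPComplete_SAT_holds.1))

end Summit.PneNP.PneNP.Theorems
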